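import Mathlib
import HarnessLib
import Literature.MathematicalPhysics.QuantumFieldTheory.ConstructiveQFTWave0
import Summits.Ventures.LatticeQCDFlow.Scaling.TunnellingLaws
import Summits.Ventures.LatticeQCDFlow.Scaling.FluxSectorCollar
import Summits.Ventures.LatticeQCDFlow.Scaling.SliceTwistWitness

/-!
# LatticeQCDFlow / Scaling — two-point invariant pairs of two thin configurations (v3.6, (C7b″) sharp form, part 1 of 4)

HONEST FRAMING: exact (Metropolis-corrected) sampling algorithms for lattice gauge theory; figures
of merit are autocorrelation/cost numbers at stated couplings and volumes; no continuum-physics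
claim.

THEORY-2.md §4 (C7), §5.15–§5.17.  `U(1) = Circle`, `d = 2`, torus `(ℤ/L)²`.

If two configurations `U`, `V` agree off an update set `Λ`, have all plaquettes within `< c` of
`1`, and carry DIFFERENT flux charges `Q = topCharge 0 0 1` (`FluxSectorCollar.lean`), then
`½(δ_U + δ_V)` with the deterministic swap `U ↔ V` is a `μ`-invariant Markov pair moving only `Λ`,
seeing no `c`-thick plaquette, and changing the flux charge — and, for every `c ≤ ε ≤ 2`, the
`ε`-sector, since `ε`-sectors refine flux sectors (`topCharge_eq_of_mem_connectedComponentIn`,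
`SliceTwistWitness.lean`) — with probability one (`exists_invariant_pair_of_two`).  Hence NO
inequality `(μ ⊗ κ){flux charge / ε-sector changes} ≤ C·μ{∃ p, dist(U_p, 1) ≥ c}` over
`μ`-invariant Markov pairs moving only `Λ` holds, whatever the constant `C` (`not_fluxLaw_of_two`,
`not_sectorLaw_of_two`).  The atom `U = 1` gives back the pairs of `SliceTwistPair.lean` /
`StripWindingPair.lean`; two NON-trivial thin atoms (a charge-zero background and the background
times a twist) are what pins the admissible threshold of a link set exactly
(`BalancedSliceTwist.lean`, `BoxSpreadPair.lean`).  These two-point measures say nothing about a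
Wilson target `μ_β`; they delimit which inequalities can hold for ALL invariant pairs.
-/

noncomputable section

namespace Summit.Ventures.LatticeQCDFlow.Theory2.Lattice.Flux

open MeasureTheory ProbabilityTheory Metric Set Filter Topology Real
open scoped ENNReal
open Literature.MathematicalPhysics.QuantumFieldTheory Literature.MathematicalPhysics.QuantumLattice

/-! ## §1. The two-point invariant pair of two thin configurations -/

section TwoPoint

variable {L : ℕ} [NeZero L]

open Classical in
/-- The two-state swap `U ↔ V`, the identity elsewhere. [folklore] -/
def swapTwo (U V W : GaugeConfig 2 L Circle) : GaugeConfig 2 L Circle :=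
  if W = U then V else if W = V then U else W

/-- The swap sends `U` to `V`. [folklore] -/
theorem swapTwo_left (U V : GaugeConfig 2 L Circle) : swapTwo U V U = V := if_pos rfl

/-- The swap sends `V ≠ U` to `U`. [folklore] -/
theorem swapTwo_right {U V : GaugeConfig 2 L Circle} (h : V ≠ U) : swapTwo U V V = U := by
  rw [swapTwo, if_neg h, if_pos rfl]

/-- The swap fixes every other configuration. [folklore] -/
theorem swapTwo_of_ne {U V W : GaugeConfig 2 L Circle} (h1 : W ≠ U) (h2 : W ≠ V) :
    swapTwo U V W = W := by
  rw [swapTwo, if_neg h1, if_neg h2]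

/-- The swap moves only links where `U` and `V` differ. [folklore] -/
theorem eq_swapTwo_of_not_mem {Λ : Set (Edge 2 L)} {U V : GaugeConfig 2 L Circle}
    (hoff : ∀ e ∉ Λ, U e = V e) (W : GaugeConfig 2 L Circle) {e : Edge 2 L} (he : e ∉ Λ) :
    W e = swapTwo U V W e := by
  by_cases h1 : W = U
  · subst h1; rw [swapTwo_left]; exact hoff e he
  · by_cases h2 : W = V
    · subst h2; rw [swapTwo_right h1]; exact (hoff e he).symm
    · rw [swapTwo_of_ne h1 h2]

/-- The swap is measurable. [folklore] -/
theorem measurable_swapTwo (U V : GaugeConfig 2 L Circle) : Measurable (swapTwo U V) := by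
  unfold swapTwo
  refine Measurable.ite ?_ measurable_const (Measurable.ite ?_ measurable_const measurable_id)
  · rw [Set.setOf_eq_eq_singleton]; exact measurableSet_singleton _
  · rw [Set.setOf_eq_eq_singleton]; exact measurableSet_singleton _

/-- The deterministic swap kernel `U ↔ V`. [folklore] -/
def swapKernelTwo (U V : GaugeConfig 2 L Circle) :
    Kernel (GaugeConfig 2 L Circle) (GaugeConfig 2 L Circle) :=
  Kernel.deterministic (swapTwo U V) (measurable_swapTwo U V)

/-- The swap kernel is Markov. [folklore] -/
instance isMarkovKernel_swapKernelTwo (U V : GaugeConfig 2 L Circle) :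
    IsMarkovKernel (swapKernelTwo U V) := by
  unfold swapKernelTwo; infer_instance

/-- The two-point measure `½(δ_U + δ_V)`. [folklore] -/
def pairMeasureTwo (U V : GaugeConfig 2 L Circle) : Measure (GaugeConfig 2 L Circle) :=
  (2 : ℝ≥0∞)⁻¹ • (Measure.dirac U + Measure.dirac V)

/-- The two-point measure is a probability measure. [folklore] -/
instance isProbabilityMeasure_pairMeasureTwo (U V : GaugeConfig 2 L Circle) :
    IsProbabilityMeasure (pairMeasureTwo U V) :=
  ⟨by rw [pairMeasureTwo, Measure.smul_apply, Measure.add_apply, measure_univ, measure_univ,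
    smul_eq_mul, one_add_one_eq_two, ENNReal.inv_mul_cancel two_ne_zero (by simp)]⟩

/-- The swap kernel at the atom `U`. [folklore] -/
theorem swapKernelTwo_apply_left (U V : GaugeConfig 2 L Circle) :
    swapKernelTwo U V U = Measure.dirac V := by
  rw [swapKernelTwo, Kernel.deterministic_apply, swapTwo_left]

/-- The swap kernel at the atom `V`. [folklore] -/
theorem swapKernelTwo_apply_right {U V : GaugeConfig 2 L Circle} (h : V ≠ U) :
    swapKernelTwo U V V = Measure.dirac U := by
  rw [swapKernelTwo, Kernel.deterministic_apply, swapTwo_right h]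

/-- **Invariance**: the swap exchanges two atoms of equal mass. [folklore] -/
theorem swapKernelTwo_invariant {U V : GaugeConfig 2 L Circle} (h : V ≠ U) :
    (swapKernelTwo U V).Invariant (pairMeasureTwo U V) := by
  show (pairMeasureTwo U V).bind (swapKernelTwo U V) = pairMeasureTwo U V
  ext s hs
  rw [Measure.bind_apply hs (Kernel.measurable _).aemeasurable, pairMeasureTwo,
    lintegral_smul_measure, lintegral_add_measure, lintegral_dirac, lintegral_dirac,
    swapKernelTwo_apply_left, swapKernelTwo_apply_right h, Measure.smul_apply, Measure.add_apply,
    add_comm]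

/-- The swap pair moves only links of `Λ`, almost surely. [folklore] -/
theorem ae_pairTwo_eq_off {Λ : Set (Edge 2 L)} {U V : GaugeConfig 2 L Circle}
    (hoff : ∀ e ∉ Λ, U e = V e) :
    ∀ᵐ q ∂(pairMeasureTwo U V ⊗ₘ swapKernelTwo U V), ∀ e ∉ Λ, q.1 e = q.2 e := by
  have hRm : MeasurableSet {q : GaugeConfig 2 L Circle × GaugeConfig 2 L Circle |
      ∀ e ∉ Λ, q.1 e = q.2 e} := by
    have hc : IsClosed {q : GaugeConfig 2 L Circle × GaugeConfig 2 L Circle |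
        ∀ e ∉ Λ, q.1 e = q.2 e} := by
      simp only [Set.setOf_forall]
      exact isClosed_iInter fun e => isClosed_iInter fun _ =>
        isClosed_eq ((continuous_apply e).comp continuous_fst)
          ((continuous_apply e).comp continuous_snd)
    exact hc.measurableSet
  refine Tunnelling.ae_compProd_of_forall
    (R := fun U U' : GaugeConfig 2 L Circle => ∀ e ∉ Λ, U e = U' e)
    (pairMeasureTwo U V) (swapKernelTwo U V) hRm fun W => ?_
  rw [swapKernelTwo, Kernel.deterministic_apply, ae_dirac_eq, Filter.eventually_pure]
  exact fun e he => eq_swapTwo_of_not_mem hoff W he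

/-- The two-point measure does not charge an event avoiding both atoms. [folklore] -/
theorem pairMeasureTwo_eq_zero_of_not_mem {U V : GaugeConfig 2 L Circle}
    {B : Set (GaugeConfig 2 L Circle)} (hU : U ∉ B) (hV : V ∉ B) : pairMeasureTwo U V B = 0 := by
  rw [pairMeasureTwo, Measure.smul_apply, Measure.add_apply, Measure.dirac_apply,
    Measure.dirac_apply, Set.indicator_of_notMem hU, Set.indicator_of_notMem hV, add_zero,
    smul_zero]

/-- The pair puts full mass on the two ordered atom pairs. [folklore] -/
theorem compProd_pairTwo_atoms {U V : GaugeConfig 2 L Circle} (h : V ≠ U) :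
    (pairMeasureTwo U V ⊗ₘ swapKernelTwo U V) {(U, V), (V, U)} = 1 := by
  have hS : MeasurableSet ({(U, V), (V, U)} :
      Set (GaugeConfig 2 L Circle × GaugeConfig 2 L Circle)) := (measurableSet_singleton _).insert _
  have hm1 : V ∈ Prod.mk U ⁻¹'
      ({(U, V), (V, U)} : Set (GaugeConfig 2 L Circle × GaugeConfig 2 L Circle)) := by simp
  have hm2 : U ∈ Prod.mk V ⁻¹'
      ({(U, V), (V, U)} : Set (GaugeConfig 2 L Circle × GaugeConfig 2 L Circle)) := by simp
  rw [pairMeasureTwo, Measure.compProd_smul_left, Measure.compProd_add_left, Measure.smul_apply,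
    Measure.add_apply, Measure.dirac_compProd_apply hS, Measure.dirac_compProd_apply hS,
    swapKernelTwo_apply_left, swapKernelTwo_apply_right h, Measure.dirac_apply_of_mem hm1,
    Measure.dirac_apply_of_mem hm2, smul_eq_mul, one_add_one_eq_two,
    ENNReal.inv_mul_cancel two_ne_zero (by simp)]

/-- Any event containing both ordered atom pairs is almost sure for the pair. [folklore] -/
theorem compProd_pairTwo_eq_one {U V : GaugeConfig 2 L Circle} (h : V ≠ U)
    {S : Set (GaugeConfig 2 L Circle × GaugeConfig 2 L Circle)} (h1 : (U, V) ∈ S)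
    (h2 : (V, U) ∈ S) : (pairMeasureTwo U V ⊗ₘ swapKernelTwo U V) S = 1 := by
  apply le_antisymm prob_le_one
  rw [← compProd_pairTwo_atoms h]
  refine measure_mono ?_
  intro q hq
  simp only [Set.mem_insert_iff, Set.mem_singleton_iff] at hq
  rcases hq with rfl | rfl
  · exact h1
  · exact h2

/-- Two `ε`-thin configurations (`ε ≤ 2`) of different flux charge lie in different `ε`-sectors
(`ε`-sectors refine flux sectors, `topCharge_eq_of_mem_connectedComponentIn`). [folklore] -/
theorem connectedComponentIn_thin_ne_of_topCharge_ne {ε : ℝ} (hε : ε ≤ 2)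
    {U V : GaugeConfig 2 L Circle} (hV : V ∈ Thin L ε)
    (hQ : topCharge (0 : Site 2 L) 0 1 U ≠ topCharge (0 : Site 2 L) 0 1 V) :
    connectedComponentIn (Thin L ε) U ≠ connectedComponentIn (Thin L ε) V := by
  intro h
  have hVU : V ∈ connectedComponentIn (Thin L ε) U := by
    rw [h]; exact mem_connectedComponentIn hV
  exact hQ (topCharge_eq_of_mem_connectedComponentIn hε (0 : Site 2 L) (μ := 0) (ν := 1)
    (by decide) hVU).symm

/-- **The invariant pair of two configurations of different charge.**  If `U`, `V` agree off `Λ`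
and have different flux charges, then some `μ`-invariant Markov pair moves only `Λ`, does not
charge any event avoiding both atoms (e.g. `{∃ p, dist(W_p, 1) ≥ c}` when both are `c`-thin), and
changes the flux charge with probability one — and the `ε`-sector too, whenever both atoms are
`ε`-thin and `ε ≤ 2`. [folklore] -/
theorem exists_invariant_pair_of_two {Λ : Set (Edge 2 L)} {U V : GaugeConfig 2 L Circle}
    (hoff : ∀ e ∉ Λ, U e = V e)
    (hQ : topCharge (0 : Site 2 L) 0 1 U ≠ topCharge (0 : Site 2 L) 0 1 V) :
    ∃ (μ : Measure (GaugeConfig 2 L Circle))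
      (κ : Kernel (GaugeConfig 2 L Circle) (GaugeConfig 2 L Circle)),
      IsProbabilityMeasure μ ∧ IsMarkovKernel κ ∧ κ.Invariant μ ∧
      (∀ᵐ q ∂(μ ⊗ₘ κ), ∀ e ∉ Λ, q.1 e = q.2 e) ∧
      (∀ B : Set (GaugeConfig 2 L Circle), U ∉ B → V ∉ B → μ B = 0) ∧
      (μ ⊗ₘ κ) {q | topCharge (0 : Site 2 L) 0 1 q.1 ≠ topCharge (0 : Site 2 L) 0 1 q.2} = 1 ∧
      ∀ ε : ℝ, U ∈ Thin L ε → V ∈ Thin L ε → ε ≤ 2 →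
        (μ ⊗ₘ κ) {q | connectedComponentIn (Thin L ε) q.1 ≠
          connectedComponentIn (Thin L ε) q.2} = 1 := by
  have hVU : V ≠ U := fun h => hQ (by rw [h])
  exact ⟨pairMeasureTwo U V, swapKernelTwo U V, inferInstance, inferInstance,
    swapKernelTwo_invariant hVU, ae_pairTwo_eq_off hoff,
    fun B hUB hVB => pairMeasureTwo_eq_zero_of_not_mem hUB hVB,
    compProd_pairTwo_eq_one hVU hQ hQ.symm, fun ε hUε hVε hε2 =>
      compProd_pairTwo_eq_one hVU (connectedComponentIn_thin_ne_of_topCharge_ne hε2 hVε hQ)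
        (connectedComponentIn_thin_ne_of_topCharge_ne hε2 hUε hQ.symm)⟩

/-- **No flux tunnelling law pricing an event that two such atoms avoid.**  If `U`, `V` agree off
`Λ`, have different flux charges and both lie outside `B`, then for ANY constant `C` the inequality
`(μ ⊗ κ){flux charge changes} ≤ C·μ(B)` fails for some `μ`-invariant Markov pair moving only `Λ`
(e.g. `B = {∃ p, dist(W_p, 1) ≥ c}` with both atoms `c`-thin, or `B = {S_P ≥ t}` with both patch
actions `< t`). [folklore] -/
theorem not_fluxLaw_of_two {Λ : Set (Edge 2 L)} {U V : GaugeConfig 2 L Circle}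
    (hoff : ∀ e ∉ Λ, U e = V e) {B : Set (GaugeConfig 2 L Circle)} (hUB : U ∉ B) (hVB : V ∉ B)
    (hQ : topCharge (0 : Site 2 L) 0 1 U ≠ topCharge (0 : Site 2 L) 0 1 V) (C : ℝ≥0∞) :
    ¬ ∀ (μ : Measure (GaugeConfig 2 L Circle)) [IsProbabilityMeasure μ]
        (κ : Kernel (GaugeConfig 2 L Circle) (GaugeConfig 2 L Circle)) [IsMarkovKernel κ],
        κ.Invariant μ → (∀ᵐ q ∂(μ ⊗ₘ κ), ∀ e ∉ Λ, q.1 e = q.2 e) →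
        (μ ⊗ₘ κ) {q | topCharge (0 : Site 2 L) 0 1 q.1 ≠ topCharge (0 : Site 2 L) 0 1 q.2} ≤
          C * μ B := by
  intro hlaw
  obtain ⟨μ, κ, hμ, hκ, hinv, hmove, hzero, hone, -⟩ := exists_invariant_pair_of_two hoff hQ
  haveI := hμ
  haveI := hκ
  have h := hlaw μ κ hinv hmove
  rw [hone, hzero B hUB hVB, mul_zero] at h
  exact one_ne_zero (le_zero_iff.mp h)

/-- **No `ε`-sector tunnelling law pricing an event that two such `ε`-thin atoms avoid**
(`ε ≤ 2`). [folklore] -/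
theorem not_sectorLaw_of_two {Λ : Set (Edge 2 L)} {U V : GaugeConfig 2 L Circle}
    (hoff : ∀ e ∉ Λ, U e = V e) {B : Set (GaugeConfig 2 L Circle)} (hUB : U ∉ B) (hVB : V ∉ B)
    (hQ : topCharge (0 : Site 2 L) 0 1 U ≠ topCharge (0 : Site 2 L) 0 1 V) {ε : ℝ}
    (hUε : U ∈ Thin L ε) (hVε : V ∈ Thin L ε) (hε2 : ε ≤ 2) (C : ℝ≥0∞) :
    ¬ ∀ (μ : Measure (GaugeConfig 2 L Circle)) [IsProbabilityMeasure μ]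
        (κ : Kernel (GaugeConfig 2 L Circle) (GaugeConfig 2 L Circle)) [IsMarkovKernel κ],
        κ.Invariant μ → (∀ᵐ q ∂(μ ⊗ₘ κ), ∀ e ∉ Λ, q.1 e = q.2 e) →
        (μ ⊗ₘ κ) {q | connectedComponentIn (Thin L ε) q.1 ≠
            connectedComponentIn (Thin L ε) q.2} ≤ C * μ B := by
  intro hlaw
  obtain ⟨μ, κ, hμ, hκ, hinv, hmove, hzero, -, hsec⟩ := exists_invariant_pair_of_two hoff hQ
  haveI := hμ
  haveI := hκ
  have h := hlaw μ κ hinv hmove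
  rw [hsec ε hUε hVε hε2, hzero B hUB hVB, mul_zero] at h
  exact one_ne_zero (le_zero_iff.mp h)

omit [NeZero L] in
/-- Thin atoms avoid the thick-plaquette event of the metric laws. [folklore] -/
theorem not_mem_thick_of_thin {U : GaugeConfig 2 L Circle} {c : ℝ}
    (hU : ∀ p : Plaquette 2 L, dist (plaquetteHolonomy U p.1 p.2.1.1 p.2.1.2) 1 < c) :
    U ∉ {W : GaugeConfig 2 L Circle | ∃ p : Plaquette 2 L,
      c ≤ dist (plaquetteHolonomy W p.1 p.2.1.1 p.2.1.2) 1} := by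
  rintro ⟨p, hp⟩; linarith [hU p]

end TwoPoint

end Summit.Ventures.LatticeQCDFlow.Theory2.Lattice.Flux
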